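import Mathlib.MeasureTheory.Integral.IntervalIntegral.Basic
import Mathlib.Analysis.SpecialFunctions.Trigonometric.Deriv
import Mathlib.Analysis.SpecialFunctions.Pow.Real
import Mathlib.Analysis.SpecialFunctions.Arsinh
import Mathlib.Analysis.Complex.UpperHalfPlane.Basic
import Literature.Probability.LatticeModels.LatticeGraph
import Literature.Probability.LatticeModels.ThermodynamicLimit
import Literature.Probability.LatticeModels.IsingModel
import Literature.Probability.LatticeModels.IsingThermodynamics
import Literature.Probability.LatticeModels.ScalingLimit
import Literature.Probability.LatticeModels.ConformalCovariance
import Literature.Probability.LatticeModels.DomainDiscretisation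
import HarnessLib

-- provenance: harness21/H21/H21/Statements/CritIsing/PlanarIsing.lean @ 83d3230 (interim HEAD d8f2665); M5 mechanical rewrite
/-!
# The planar Ising model: Onsager's solution and conformal invariance of spin correlations

Trunk G02 (T-STATMECH), family `crit-ising`, statement file
`Statements/CritIsing/PlanarIsing.lean` (ids **crit-ising.S14**, **crit-ising.S15**,
**crit-ising.S16**). Dimension `d = 2` throughout.

Contents:

* `criticalBetaTwo = log (1 + √2) / 2`, the self-dual point of the square-lattice Ising model, and
  **crit-ising.S15**: Onsager's formula for the pressure (`onsager_pressure`) together with the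
  identification `criticalBeta 2 = criticalBetaTwo` (`criticalBeta_two`). Sources: L. Onsager,
  Phys. Rev. 65 (1944) 117; B. Kaufman, Phys. Rev. 76 (1949); rigorous: Schultz–Mattis–Lieb, Rev.
  Mod. Phys. 36 (1964) 856; `β_c`: Kramers–Wannier duality + Aizenman–Barsky–Fernández (1987), see
  Friedli–Velenik, *Statistical Mechanics of Lattice Systems* (CUP 2017), §3.10.1 and Thm 3.25.
* **crit-ising.S16**: the Onsager–Yang spontaneous magnetisation `m*(β) = (1 - sinh(2β)^{-4})^{1/8}`
  for `β > β_c` and `0` otherwise (`onsager_yang`). Sources: C. N. Yang, Phys. Rev. 85 (1952) 808;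
  rigorous: Benettin–Gallavotti–Jona-Lasinio–Stella, Comm. Math. Phys. 30 (1973) 45;
  Abraham–Martin-Löf, Comm. Math. Phys. 32 (1973) 245.
* **crit-ising.S14**: conformal invariance of the scaling limit of critical spin correlations with `+`
  boundary conditions in bounded simply connected planar domains (Chelkak–Hongler–Izyurov,
  *Conformal invariance of spin correlations in the planar Ising model*, Ann. Math. 181 (2015)
  1087–1138, Thms 1.1–1.3 (CHI)): the discrete correlation `meshIsingPlusCorr Ω δ a =
  𝔼⁺_{Ω_δ}[σ_{a₁} ⋯ σ_{aₙ}]` and its `δ → 0⁺` limit `chiPlusCorr`. The three CHI statements first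
  transcribed here — the convergence-with-covariance statement `chi_conformal_invariance` (shape
  fixed by the outline), the covariance of the limit family `isConformallyCovariant_chiPlusCorr` and
  the explicit one-point function transported from the half plane, `chi_halfplane_onePoint` (CHI
  eq. (1.3)) — omit CHI's approximation hypothesis and survive only as `@[deprecated]` records
  (Erratum and Verdict clean-up below); the live, CHI-faithful statements are in
  `PlanarIsingOnePoint.lean`. The explicit `n = 2` half-plane formula of CHI Thm 1.1 / eq. (1.3)
  is NOT stated (it should only be transcribed verbatim from the source).

Erratum (2026-08-14; CHI = arXiv:1202.2838, numbering of the arXiv version). Every theorem of CHI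
carries the standing hypothesis that the discrete domains *approximate* `Ω`: "`∂Ω_δ` converges to
`∂Ω` in the Hausdorff sense" (CHI §2, p. 13; Thms 1.1, 1.3: "`Ω_δ` discretizations of `Ω`"). The
three CHI statements below (`chi_conformal_invariance`, `isConformallyCovariant_chiPlusCorr`,
`chi_halfplane_onePoint`) instead quantify over ALL admissible `Ω` with the FIXED scheme
`meshDomain Ω δ` of `DomainDiscretisation.lean`, whose mesh graph tests edges against the closure
`Ω̄`; a slit of `Ω` carrying no lattice point is therefore invisible to the discretisation at every
scale. Consequences, all recorded in sibling files (which import this one, so only their names can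
be quoted here):
* `chi_halfplane_onePoint` is FALSE as stated:
  `Literature.Probability.LatticeModels.not_chi_halfplane_onePoint` (`PlanarIsingSlitDisc.lean`:
  the unit disc slit along `{t e^{iπ/3} | t ≥ 1/4}` has the same discrete data as the disc at every
  `δ`, hence the same `chiPlusCorr`, while the right-hand side distinguishes them,
  `rad(0, 𝔻) = 1 ≠ 16/25`). The `def` is kept because the refutation and the correction refer to
  it; do not use it as a hypothesis (anything proved from it is vacuous).
* The corrected statement, with CHI's hypothesis made explicit as
  `Literature.Probability.LatticeModels.MeshApproximates Ω`, is
  `Literature.Probability.LatticeModels.chi_halfplane_onePoint_hausdorff` (`PlanarIsingOnePoint.lean`),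
  proved there from the named facts `chi_onePoint_rho` (CHI Thm 1.3, `k = 0`, with (1.2)–(1.3)) and
  `wu_rhoCHI` (Wu's asymptotics `ϱ(δ) ∼ 𝒞₂ δ^{1/4}`, CHI Remark 1.2 (iii) — needed to pass from CHI's
  `ϱ(δ)^{-1/2}` normalisation to the `δ^{-1/8}` normalisation used here).
* `chi_conformal_invariance` and `isConformallyCovariant_chiPlusCorr` are likewise NOT consequences
  of CHI: by the same coincidence and the covariance clause they force the limit of
  `δ^{-1/8} 𝔼⁺_{𝔻_δ}[σ_0]` for the unit disc to be `0`, whereas CHI Thm 1.3 with Remark 1.2 (iii)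
  gives the positive value `𝒞₁ rad(0, 𝔻)^{-1/8}`. Formalised in `PlanarIsingCovarianceVanishing.lean`
  (2026-08-15): `Literature.Probability.LatticeModels.chiPlusCorr_onePoint_eq_zero_of_covariant`
  (covariance as stated forces `chiPlusCorr Ω 1 ![a] = 0` for EVERY admissible `Ω` and `a ∈ Ω`, via
  the slit disc, an explicit conformal map slit disc → disc with `|ψ'(0)| = 25/16`, and the Riemann
  mapping theorem) and the conditional refutations
  `Literature.Probability.LatticeModels.not_isConformallyCovariant_chiPlusCorr_of`,
  `Literature.Probability.LatticeModels.not_chi_conformal_invariance_of` from the named facts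
  `chi_onePoint_rho` (CHI Thm 1.3, `k = 0`) and `wu_rhoCHI` (Wu; CHI Remark 1.2 (iii)) together with
  `meshApproximates_ball` (`PlanarIsingDiscApprox.lean`); an unconditional refutation would need
  that positive lower bound, i.e. CHI's theorem itself. Use them only in the corrected forms carrying
  `MeshApproximates Ω` (`PlanarIsingOnePoint.lean`). `tendsto_chiPlusCorr` (mere existence of the
  limit) is not contradicted by the coincidence argument (an everywhere-invisible slit does not
  obstruct existence), but it is by a slit of *rational height*, which the fixed scheme resolves at
  some meshes and not at others (2026-08-15): the translate `i/2 + Ω_A` of the axis-slit disc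
  `Ω_A = 𝔻 ∖ ([1/4, 1) × {0})` is discretised exactly like the translated disc `i/2 + 𝔻` at the odd
  meshes `δ = 1/(2m+1)` (no lattice row at height `1/2`) and is the lattice translate of `Ω_A` at the
  even meshes `δ = 1/(2(m+1))` (`PlanarIsingMeshTranslate.lean`, `PlanarIsingRationalSlit.lean`), while
  `Ω_A` does satisfy `MeshApproximates` (`PlanarIsingAxisSlitApprox.lean`); CHI Thm 1.3 (`k = 0`) + Wu
  then give two different subsequential limits (conformal radii `16/25` and `1` at the marked point), so
  `Literature.Probability.LatticeModels.AxisSlitDisc.not_tendsto_chiPlusCorr_of_chi :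
  chi_onePoint_rho → wu_rhoCHI → ¬ tendsto_chiPlusCorr`.

Verdict clean-up (2026-08-15). Following the prove-seat verdicts on the three statements
(`chi_conformal_invariance`: mis-stated; `isConformallyCovariant_chiPlusCorr`: mis-stated;
`chi_halfplane_onePoint`: refuted), re-verified against arXiv:1202.2838 (§1.1: "we are interested
in the setup when `Ω_δ` approximate some simply connected domain `Ω`"; Thms 1.1, 1.3: "`Ω_δ`
discretizations of `Ω`"; §2.6, conventions: "approximates" = `∂Ω_δ → ∂Ω` in the Hausdorff sense),
the three defs are `@[deprecated]` RECORDS, not live named facts: their statements are kept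
verbatim only because the refutations and consequence theorems of `PlanarIsingSlitDisc.lean` /
`PlanarIsingCovarianceVanishing.lean` name them (`linter.deprecated` is silenced on exactly those
declarations); nothing else may use them. Replacements (all in `PlanarIsingOnePoint.lean`, prefix
`Literature.Probability.LatticeModels.`): `chi_conformal_invariance` ↦
`chi_conformal_invariance_hausdorff` (named fact, proved from `chi_multiPoint_rho` + `wu_rhoCHI`);
`isConformallyCovariant_chiPlusCorr` ↦ `chiPlusCorr_covariant_of_hausdorff` (theorem);
`chi_halfplane_onePoint` ↦ `chi_halfplane_onePoint_hausdorff` (named fact, proved from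
`chi_onePoint_rho` + `wu_rhoCHI`). `tendsto_chiPlusCorr` (prove-seat verdict 2026-08-15:
mis-stated, refuted conditionally on CHI Thm 1.3 (`k = 0`) + Wu by
`Literature.Probability.LatticeModels.AxisSlitDisc.not_tendsto_chiPlusCorr_of_chi`,
`PlanarIsingAxisSlitApprox.lean`) is likewise a RECORD: its statement is unchanged because the
refutation theorems of `PlanarIsingRationalSlit.lean` / `PlanarIsingAxisSlitApprox.lean` name it; it
is not marked `@[deprecated]` only to spare those files the linter silencing; nothing may use it as a
hypothesis. Replacement: `tendsto_chiPlusCorr_of_hausdorff` (`PlanarIsingOnePoint.lean`, theorem,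
hypothesis `MeshApproximates Ω`, from `chi_conformal_invariance_hausdorff`).

Design choices.
* The discrete domain `Ω_δ` and its graph are `meshDomain`/`discreteDomainGraph` of
  `Literature.Prelude.StatMech.DomainDiscretisation`. Following CHI §1.2 ("`σ ≡ +1` on `∂Ω_δ`") the `+`
  boundary condition sits on the discrete boundary `∂Ω_δ = meshBoundary Ω δ`: the Ising measure
  is `isingMeasure (discreteDomainGraph Ω δ) Λ β_c 0 .plus` with volume `Λ = Ω_δ \ ∂Ω_δ`, the
  *interior* of `Ω_δ` (`meshInteriorFinset`), so that every edge of `Ω_δ` from an interior vertex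
  to `∂Ω_δ` enters the Hamiltonian with the boundary spin frozen to `+1` (the graph
  `discreteDomainGraph Ω δ` has no edges leaving `Ω_δ`, so taking all of `Ω_δ` as the volume
  would silently give *free* boundary conditions). `meshInteriorFinset Ω δ` is a `Finset` via
  `meshDomain_finite` when `Ω` is bounded and `0 < δ`, and `∅` otherwise (documented junk: empty
  volume, all spins frozen to `+1`). A marked point `aᵢ` is read at `nearestSite δ (aᵢ)`, which
  for large `δ` may lie on `∂Ω_δ` or outside `Ω_δ` (where the spin reads `+1`); this is harmless
  for the `δ → 0⁺` statements since `Ω` is open.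
* Spin correlations are expectations of the *product* `spinMonomial` (outline §0), so coincident
  rounded sites give the correct value `σ² = 1`.
* `isingExpect` needs `LocallyFinite` for `discreteDomainGraph Ω δ`; we provide it as an instance
  with a real proof (subgraph of the locally finite `zdGraph 2`).
* CHI normalise the continuum correlations by `⟨σ_a⟩⁺_ℍ = 2^{1/4} (2 Im a)^{-1/8}` and put a
  lattice-dependent constant `𝒞_σ` in front (`𝒞_σ = 2^{5/48} e^{-3ζ'(-1)/2}` for the square
  lattice). We do not fix these conventions: `chi_conformal_invariance` (and its replacement
  `chi_conformal_invariance_hausdorff`) quantifies existentially over the family `S` and the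
  constant `C`, and `chi_halfplane_onePoint` (and `chi_halfplane_onePoint_hausdorff`) states the
  one-point function of the actual limit `chiPlusCorr` up to one positive constant (theirs:
  `𝒞_σ · 2^{1/4}`).
  The half plane itself is unbounded, hence not an admissible domain of
  `IsConformallyCovariant`; the `ℍ`-formula is therefore stated in transported form
  `⟨σ_a⟩⁺_Ω = |φ'(a)|^{1/8} ⟨σ_{φ a}⟩⁺_ℍ` for conformal bijections `φ : Ω → ℍ` (CHI (1.2)–(1.3)).

Mathlib anchors used (searched, not re-defined): `intervalIntegral` (`∫ θ in a..b`), `Real.cosh`,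
`Real.sinh`, `Real.arsinh` (`Real.sinh_arsinh`), `Real.log`, `Real.sqrt`, `Real.rpow`, zpow on
`ℝ`, `UpperHalfPlane.upperHalfPlaneSet`
(`{z : ℂ | 0 < z.im}`, `Mathlib.Analysis.Complex.UpperHalfPlane.Basic`), `deriv`, `nhdsWithin`,
`limUnder`, `SimpleGraph.neighborSet_mono`, `Set.Finite.toFinset`. Mathlib has no Ising model, no
Onsager formula and no lattice discretisation of planar domains.
-/

noncomputable section

open MeasureTheory Filter Topology Real
open Literature.Probability.LatticeModels

namespace Literature.Probability.LatticeModels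

/-! ### The critical point of the square lattice -/

/-- The critical inverse temperature of the nearest-neighbour Ising model on `ℤ²`,
`β_c(2) = ½ log (1 + √2)`, the self-dual point of Kramers–Wannier duality
(`sinh (2β_c) = 1`, i.e. `β_c(2) = arsinh 1 / 2`, see `criticalBetaTwo_eq_arsinh_div_two`).
(Onsager, Phys. Rev. 65 (1944) 117; Friedli–Velenik 2017, §3.10.1, Theorem 3.25 with the
two-dimensional value.) [cite: FriedliVelenik2017, §3.10.1  Theorem 3.25 with the two-dimen] -/
def criticalBetaTwo : ℝ := Real.log (1 + Real.sqrt 2) / 2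

/-- `β_c(2) = ½ arsinh 1` (Mathlib's `Real.arsinh x = log (x + √(1 + x²))`).
(Friedli–Velenik 2017, §3.10.1.) [cite: FriedliVelenik2017, §3.10.1] -/
theorem criticalBetaTwo_eq_arsinh_div_two : criticalBetaTwo = Real.arsinh 1 / 2 := by
  simp [criticalBetaTwo, Real.arsinh]; norm_num

/-- `β_c(2) > 0`. (Friedli–Velenik 2017, §3.10.1.) [cite: FriedliVelenik2017, §3.10.1] -/
theorem criticalBetaTwo_pos : 0 < criticalBetaTwo := by
  rw [criticalBetaTwo_eq_arsinh_div_two]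
  exact div_pos (Real.arsinh_pos_iff.2 one_pos) two_pos

/-- The self-duality equation `sinh (2 β_c(2)) = 1`. (Onsager 1944; Friedli–Velenik 2017,
§3.10.1, Kramers–Wannier duality.) [cite: Onsager1944] -/
theorem sinh_two_mul_criticalBetaTwo : Real.sinh (2 * criticalBetaTwo) = 1 := by
  rw [criticalBetaTwo_eq_arsinh_div_two, mul_div_cancel₀ _ two_ne_zero, Real.sinh_arsinh]

/-! ### crit-ising.S15: Onsager's pressure and `β_c(2)` -/

/-- Onsager's closed form for the pressure of the square-lattice Ising model at zero field,
`ψ(β) = log 2 + (8π²)⁻¹ ∫₀^{2π} ∫₀^{2π} log (cosh²(2β) − sinh(2β) (cos θ₁ + cos θ₂)) dθ₁ dθ₂`.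
(Onsager, Phys. Rev. 65 (1944) 117, eq. (109); Schultz–Mattis–Lieb, Rev. Mod. Phys. 36 (1964).) [folklore] -/
def onsagerPressure (β : ℝ) : ℝ :=
  Real.log 2 + (1 / (8 * π ^ 2)) *
    ∫ θ₁ in (0 : ℝ)..2 * π, ∫ θ₂ in (0 : ℝ)..2 * π,
      Real.log (Real.cosh (2 * β) ^ 2 - Real.sinh (2 * β) * (Real.cos θ₁ + Real.cos θ₂))

/-- **crit-ising.S15** (Onsager's free energy; Onsager, Phys. Rev. 65 (1944) 117; Kaufman 1949;
rigorous: Schultz–Mattis–Lieb, Rev. Mod. Phys. 36 (1964); Friedli–Velenik 2017, §3.10.1).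
For the nearest-neighbour Ising model on `ℤ²` at `h = 0` and every real `β`,
`lim_{L → ∞} |B(L)|⁻¹ log Z_{B(L)}^∅(β) = onsagerPressure β
  = log 2 + (8π²)⁻¹ ∫₀^{2π} ∫₀^{2π} log (cosh²(2β) − sinh(2β) (cos θ₁ + cos θ₂)) dθ₁ dθ₂`
(limit along boxes, `HasBoxLimit`; no sign restriction on `β`: both sides are even in `β`, the
left by bipartiteness of `ℤ²`, the right by `θ ↦ θ + π`). [cite: Kaufman1949] -/
def onsager_pressure : Prop :=
  ∀ (β : ℝ),
    HasBoxLimit (fun Λ => pressureIn (zdGraph 2) Λ β 0 .free) (onsagerPressure β)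

/-- Onsager's formula identifies the infinite-volume pressure `pressure 2 β 0` of
`Literature.Prelude.StatMech.IsingThermodynamics` with `onsagerPressure β` (uniqueness of limits from
`onsager_pressure` and `hasBoxLimit_pressureIn`). (Onsager 1944; Friedli–Velenik 2017, Thm 3.6.) [cite: Onsager1944] -/
def pressure_two_eq_onsagerPressure : Prop :=
  ∀ (β : ℝ),
    pressure 2 β 0 = onsagerPressure β

/- interim proof relied on results that are now named facts (D-0014); demoted to a fact by the M5 import, proof preserved:
:=
  tendsto_nhds_unique (hasBoxLimit_pressureIn 2 β 0 .free) (onsager_pressure β)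
-/

/-- **crit-ising.S15** (value of the critical point; Kramers–Wannier 1941 self-duality, Onsager
1944, made rigorous by Aizenman–Barsky–Fernández 1987 / Beffara–Duminil-Copin 2012; Friedli–Velenik
2017, Theorem 3.25 and §3.10.1). The critical inverse temperature of the square-lattice Ising
model, `β_c(2) = inf {β ≥ 0 | m*(β) > 0}`, equals `½ log (1 + √2)`. [cite: KramersWannier1941, self-duality  Onsager 1944  made rigorou] -/
def criticalBeta_two : Prop :=
  criticalBeta 2 = criticalBetaTwo

/-! ### crit-ising.S16: Onsager–Yang spontaneous magnetisation -/

/-- **crit-ising.S16** (Onsager–Yang spontaneous magnetisation; Yang, Phys. Rev. 85 (1952) 808;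
rigorous: Benettin–Gallavotti–Jona-Lasinio–Stella, Comm. Math. Phys. 30 (1973) 45;
Abraham–Martin-Löf, Comm. Math. Phys. 32 (1973) 245; McCoy–Wu, *The two-dimensional Ising model*
(1973)). For the nearest-neighbour Ising model on `ℤ²` and `β ≥ 0`,
`m*(β) = (1 − sinh(2β)^{-4})^{1/8}` if `β > β_c(2) = ½ log (1 + √2)` and `m*(β) = 0` if
`β ≤ β_c(2)`; in particular the magnetisation exponent is `1/8`. [cite: BenettinGallavottiJonaLasinioStella1973, main theorem (rigorous Onsager–Yang formula)] [cite: YangPhysRev1952] -/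
def onsager_yang : Prop :=
  ∀ (β : ℝ) (hβ : 0 ≤ β),
    spontaneousMagnetization 2 β =
      if criticalBetaTwo < β then (1 - Real.sinh (2 * β) ^ (-(4 : ℤ))) ^ ((1 : ℝ) / 8) else 0

/-- Continuity of the planar magnetisation at `β_c`: `m*(β_c(2)) = 0` (the `β ≤ β_c` branch of
the Onsager–Yang formula; Yang 1952; Benettin et al. 1973). [cite: Yang1952] -/
def spontaneousMagnetization_two_criticalBetaTwo : Prop :=
  spontaneousMagnetization 2 criticalBetaTwo = 0

/- interim proof relied on results that are now named facts (D-0014); demoted to a fact by the M5 import, proof preserved: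
:= by
  have h := onsager_yang criticalBetaTwo criticalBetaTwo_pos.le
  simpa using h
-/

/-! ### crit-ising.S14: conformal invariance of critical spin correlations (CHI) -/

/-- The graph `Ω_δ` is locally finite, being a subgraph of the nearest-neighbour graph `ℤ²`
(`discreteDomainGraph_le_meshGraph`, `meshGraph_le_zdGraph`). (Chelkak–Smirnov 2012, §1.2.) [cite: ChelkakSmirnov2012, §1.2] -/
instance instLocallyFiniteDiscreteDomainGraph (Ω : Set ℂ) (δ : ℝ) :
    (discreteDomainGraph Ω δ).LocallyFinite := fun x =>
  (((zdGraph 2).neighborSet x).toFinite.subset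
    (SimpleGraph.neighborSet_mono
      ((discreteDomainGraph_le_meshGraph Ω δ).trans (meshGraph_le_zdGraph Ω δ)) x)).fintype

/-- The vertex set of `Ω_δ` as a `Finset`, for a bounded domain and a positive mesh
(`meshDomain_finite`); the empty set (junk) otherwise. (Chelkak–Hongler–Izyurov 2015, §1.2.) [cite: ChelkakHonglerIzyurov2015, §1.2] -/
def meshDomainFinset (Ω : Set ℂ) (δ : ℝ) : Finset (Site 2) :=
  open scoped Classical in
  if h : Bornology.IsBounded Ω ∧ 0 < δ then (meshDomain_finite h.1 h.2).toFinset else ∅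

/-- For bounded `Ω` and `δ > 0`, `meshDomainFinset Ω δ` is exactly the discrete domain
`meshDomain Ω δ`. (Chelkak–Hongler–Izyurov 2015, §1.2.) [cite: ChelkakHonglerIzyurov2015, §1.2] -/
theorem coe_meshDomainFinset {Ω : Set ℂ} {δ : ℝ} (hΩ : Bornology.IsBounded Ω) (hδ : 0 < δ) :
    (meshDomainFinset Ω δ : Set (Site 2)) = meshDomain Ω δ := by
  classical
  simp [meshDomainFinset, hΩ, hδ]

/-- The interior `Ω_δ \ ∂Ω_δ` of the discrete domain as a `Finset` (the vertices of
`meshDomain Ω δ` not in the discrete boundary `meshBoundary Ω δ`), for a bounded domain and a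
positive mesh (`meshDomain_finite`); the empty set (junk) otherwise. This is the volume of the
`+`-boundary-condition Ising measure of CHI: spins are free on the interior and `≡ +1` on `∂Ω_δ`.
(Chelkak–Hongler–Izyurov, Ann. Math. 181 (2015), §1.2.) [folklore] -/
def meshInteriorFinset (Ω : Set ℂ) (δ : ℝ) : Finset (Site 2) :=
  open scoped Classical in
  if h : Bornology.IsBounded Ω ∧ 0 < δ then
    (meshDomain_finite h.1 h.2).toFinset.filter (· ∉ meshBoundary Ω δ) else ∅

/-- For bounded `Ω` and `δ > 0`, `meshInteriorFinset Ω δ` is exactly `Ω_δ \ ∂Ω_δ`.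
(Chelkak–Hongler–Izyurov 2015, §1.2.) [cite: ChelkakHonglerIzyurov2015, §1.2] -/
theorem coe_meshInteriorFinset {Ω : Set ℂ} {δ : ℝ} (hΩ : Bornology.IsBounded Ω) (hδ : 0 < δ) :
    (meshInteriorFinset Ω δ : Set (Site 2)) = meshDomain Ω δ \ meshBoundary Ω δ := by
  classical
  ext x
  simp [meshInteriorFinset, hΩ, hδ]

/-- The interior volume is contained in the discrete domain.
(Chelkak–Hongler–Izyurov 2015, §1.2.) [cite: ChelkakHonglerIzyurov2015, §1.2] -/
theorem meshInteriorFinset_subset_meshDomainFinset (Ω : Set ℂ) (δ : ℝ) :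
    meshInteriorFinset Ω δ ⊆ meshDomainFinset Ω δ := by
  classical
  unfold meshInteriorFinset meshDomainFinset
  split_ifs with h
  · exact Finset.filter_subset _ _
  · exact le_rfl

/-- The discrete critical spin correlation with `+` boundary conditions,
`𝔼⁺_{Ω_δ}[σ_{[a₁/δ]} ⋯ σ_{[aₙ/δ]}]`: the expectation, under the Ising measure of the graph
`Ω_δ = discreteDomainGraph Ω δ` in the volume `Ω_δ \ ∂Ω_δ` (`meshInteriorFinset Ω δ`) at
`β = β_c(2)`, `h = 0`, with all spins outside the volume — in particular on the discrete
boundary `∂Ω_δ = meshBoundary Ω δ`, which carries every edge of `Ω_δ` leaving the interior —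
frozen to `+1` (CHI §1.2: "`σ ≡ +1` on `∂Ω_δ`"), of the product of the spins at the sites
nearest to the marked points `aᵢ` (a product, so coincident rounded sites contribute `σ² = 1`;
a rounded site on `∂Ω_δ` or outside `Ω_δ`, possible for large `δ`, reads `+1`). Junk value for
unbounded `Ω` or `δ ≤ 0`: empty volume, all spins frozen to `+1`, value `1`.
(Chelkak–Hongler–Izyurov, Ann. Math. 181 (2015), §1.2 and Thm 1.1.) [folklore] -/
def meshIsingPlusCorr {n : ℕ} (Ω : Set ℂ) (δ : ℝ) (a : Fin n → ℂ) : ℝ :=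
  isingExpect (discreteDomainGraph Ω δ) (meshInteriorFinset Ω δ) criticalBetaTwo 0 .plus
    (spinMonomial fun i => nearestSite δ (a i))

/-- The CHI scaling limit of the renormalised critical spin correlations,
`Ω, n, a ↦ lim_{δ → 0⁺} δ^{-n/8} 𝔼⁺_{Ω_δ}[σ_{a₁} ⋯ σ_{aₙ}]` (as a `limUnder` along `𝓝[>] 0`;
**junk-valued** where the limit does not exist — it exists, by
`Literature.Probability.LatticeModels.tendsto_chiPlusCorr_of_hausdorff` (`PlanarIsingOnePoint.lean`,
from CHI Thm 1.3 and Wu's asymptotics as named facts), for admissible `Ω` whose discretisations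
approximate `Ω` in CHI's sense (`Literature.Probability.LatticeModels.MeshApproximates Ω`) and
distinct `aᵢ ∈ Ω`). In CHI's notation this is `𝒞_σ^n ⟨σ_{a₁} ⋯ σ_{aₙ}⟩⁺_Ω`, lattice constant
included. (Chelkak–Hongler–Izyurov, Ann. Math. 181 (2015), Thm 1.1, eq. (1.2).) [folklore] -/
def chiPlusCorr : PlanarCorrFamily := fun Ω n a =>
  limUnder (𝓝[>] (0 : ℝ)) fun δ => δ ^ (-(n : ℝ) / 8) * meshIsingPlusCorr Ω δ a

/-- **Deprecated record — MIS-STATED** (prove-seat verdict; verdict clean-up 2026-08-15; never use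
it as a hypothesis). First transcription of **crit-ising.S14** (conformal invariance of spin
correlations in the planar Ising model; Chelkak–Hongler–Izyurov, Ann. Math. 181 (2015) 1087,
arXiv:1202.2838, Thms 1.1–1.3 with the covariance (1.2)): "there is a family of continuum
correlation functions `⟨σ_{a₁} ⋯ σ_{aₙ}⟩⁺_Ω`, conformally covariant with exponent `1/8`
(`⟨σ_{φ a₁} ⋯⟩⁺_{φ Ω} = ∏ᵢ |φ'(aᵢ)|^{-1/8} ⟨σ_{a₁} ⋯⟩⁺_Ω` for conformal bijections `φ`), and a
lattice-dependent constant `𝒞 > 0`, such that for every bounded simply connected domain `Ω`,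
discretised by `Ω_δ ⊆ δℤ²` with `+` boundary conditions at `β_c = ½ log (1 + √2)`, and all
distinct `a₁, …, aₙ ∈ Ω`, `δ^{-n/8} 𝔼⁺_{Ω_δ}[σ_{a₁} ⋯ σ_{aₙ}] → 𝒞ⁿ ⟨σ_{a₁} ⋯ σ_{aₙ}⟩⁺_Ω` as
`δ → 0⁺`." **What is wrong:** CHI prove this for discrete domains `Ω_δ` that *approximate* `Ω`
(arXiv:1202.2838 §1.1; Thms 1.1, 1.3: "`Ω_δ` discretizations of `Ω`"; §2.6: `∂Ω_δ → ∂Ω` in the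
Hausdorff sense), whereas this def quantifies over ALL admissible `Ω` with the FIXED scheme
`meshDomain Ω δ`, which cannot see a slit of `Ω` carrying no lattice point (module docstring,
Erratum). It is therefore not CHI's theorem and is false on paper; in tree it is refuted
conditionally on CHI Thm 1.3 (`k = 0`) + Wu by
`Literature.Probability.LatticeModels.not_chi_conformal_invariance_of`, and it forces the
renormalised magnetisation `δ^{-1/8} 𝔼⁺_{Ω_δ}[σ_a]` to tend to `0` for every admissible `Ω` and
`a ∈ Ω` (`Literature.Probability.LatticeModels.tendsto_onePoint_zero_of_chi_conformal_invariance`,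
both `PlanarIsingCovarianceVanishing.lean`). **Replacement:** the corrected statement, with CHI's
hypothesis `Literature.Probability.LatticeModels.MeshApproximates Ω` in the convergence clause, is
`Literature.Probability.LatticeModels.chi_conformal_invariance_hausdorff` (`PlanarIsingOnePoint.lean`,
proved there from the named facts `chi_multiPoint_rho` = CHI Thm 1.3 with (1.2) and `wu_rhoCHI` =
CHI Rem. 1.2 (iii)). The statement below is unchanged and kept only because those theorems name it.
[cite: arXiv12022838, Thms 1.1–1.3 with eq. (1.2) — MIS-TRANSCRIBED without the approximation hypothesis of §1.1 and §2.6; corrected as chi_conformal_invariance_hausdorff] -/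
@[deprecated "mis-stated (omits CHI's standing hypothesis that the discrete domains approximate Ω, arXiv:1202.2838 §1.1 and §2.6; conditionally refuted by Literature.Probability.LatticeModels.not_chi_conformal_invariance_of): use Literature.Probability.LatticeModels.chi_conformal_invariance_hausdorff of PlanarIsingOnePoint.lean" (since := "2026-08-15")]
def chi_conformal_invariance : Prop :=
  ∃ (S : PlanarCorrFamily) (C : ℝ), 0 < C ∧ IsConformallyCovariant (1 / 8) S ∧
      ∀ Ω, IsAdmissibleDomain Ω → ∀ n (a : Fin n → ℂ), Function.Injective a → (∀ i, a i ∈ Ω) →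
        Tendsto (fun δ => δ ^ (-(n : ℝ) / 8) * meshIsingPlusCorr Ω δ a) (𝓝[>] 0)
          (𝓝 (C ^ n * S Ω n a))

/-- **Record — MIS-STATED and REFUTED relative to CHI** (prove-seat verdict 2026-08-15; never use
it as a hypothesis). First transcription of a consequence of **crit-ising.S14**: "for admissible `Ω`
and distinct marked points the renormalised discrete correlations `δ^{-n/8} 𝔼⁺_{Ω_δ}[σ_{a₁}⋯σ_{aₙ}]`
converge (to `chiPlusCorr Ω n a`)" (Chelkak–Hongler–Izyurov 2015, Thm 1.1). **What is wrong:** CHI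
prove this only for discrete domains `Ω_δ` *approximating* `Ω` (`∂Ω_δ → ∂Ω` in the Hausdorff sense,
arXiv:1202.2838 §1.1 and §2.6; Thm 1.1: "`Ω_δ` discretizations of `Ω`"), whereas this def
quantifies over ALL admissible `Ω` with the FIXED scheme `meshDomain Ω δ`, which resolves a slit at
rational height only at some meshes: for the translate `i/2 + Ω_A` of the axis-slit disc
`Ω_A = 𝔻 ∖ ([1/4, 1) × {0})`, marked at `i/2`, the odd meshes `1/(2m+1)` see the translated disc and
the even meshes `1/(2(m+1))` see (a lattice translate of) `Ω_A`, whose CHI limits differ (conformal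
radii `1` and `16/25`). Hence it is refuted conditionally on CHI Thm 1.3 (`k = 0`) + Wu:
`Literature.Probability.LatticeModels.AxisSlitDisc.not_tendsto_chiPlusCorr_of_chi :
chi_onePoint_rho → wu_rhoCHI → ¬ tendsto_chiPlusCorr` (`PlanarIsingAxisSlitApprox.lean`, with
`PlanarIsingRationalSlit.lean` and `PlanarIsingMeshTranslate.lean`); an unconditional refutation would
need CHI's positive limits themselves. **Replacement:** the corrected statement carrying CHI's hypothesis
`Literature.Probability.LatticeModels.MeshApproximates Ω` is the theorem
`Literature.Probability.LatticeModels.tendsto_chiPlusCorr_of_hausdorff` (`PlanarIsingOnePoint.lean`,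
from `chi_conformal_invariance_hausdorff`, itself proved from the named facts `chi_multiPoint_rho` =
CHI Thm 1.3 with (1.2) and `wu_rhoCHI` = CHI Rem. 1.2 (iii)). The statement below is unchanged and
kept only because the refutation theorems name it. [cite: ChelkakHonglerIzyurov2015, Thm 1.1 — MIS-TRANSCRIBED without the approximation hypothesis of §1.1 and §2.6; corrected as tendsto_chiPlusCorr_of_hausdorff] -/
def tendsto_chiPlusCorr : Prop :=
  ∀ {Ω : Set ℂ} (hΩ : IsAdmissibleDomain Ω) {n : ℕ} {a : Fin n → ℂ} (ha : Function.Injective a) (haΩ : ∀ i, a i ∈ Ω),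
    Tendsto (fun δ => δ ^ (-(n : ℝ) / 8) * meshIsingPlusCorr Ω δ a) (𝓝[>] 0)
      (𝓝 (chiPlusCorr Ω n a))

/- interim proof relied on results that are now named facts (D-0014); demoted to a fact by the M5 import, proof preserved:
:= by
  obtain ⟨S, C, -, -, h⟩ := chi_conformal_invariance
  exact tendsto_nhds_limUnder ⟨_, h Ω hΩ n a ha haΩ⟩
-/

/-- **Deprecated record — MIS-STATED** (prove-seat verdict; verdict clean-up 2026-08-15; never use
it as a hypothesis). First transcription of the covariance clause of **crit-ising.S14** for the
limit family: "the CHI limit family `chiPlusCorr` is conformally covariant with exponent `1/8`"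
(Chelkak–Hongler–Izyurov 2015, Thm 1.3 eq. (1.2), Rem. 1.2 (ii); originally derived here from
`chi_conformal_invariance` by uniqueness of limits, the constant `𝒞ⁿ` being the same on both
sides — that derivation survives as
`Literature.Probability.LatticeModels.isConformallyCovariant_chiPlusCorr_of_chi_conformal_invariance`).
**What is wrong:** CHI's covariance (1.2) concerns the continuum functions `⟨σ_{a₀}⋯σ_{a_k}⟩⁺_Ω`,
identified with limits of discrete correlations only along discretisations approximating `Ω`
(arXiv:1202.2838 §1.1, §2.6); asserted for `chiPlusCorr` between ALL pairs of admissible domains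
(fixed scheme `meshDomain`) it relates the slit unit disc of `PlanarIsingSlitDisc.lean` — same
`chiPlusCorr` as the disc, conformal radius `16/25` instead of `1` at `0` — to the disc, and thereby
forces `chiPlusCorr Ω 1 ![a] = 0` for EVERY admissible `Ω` and `a ∈ Ω`
(`Literature.Probability.LatticeModels.chiPlusCorr_onePoint_eq_zero_of_covariant`), against CHI's
positive one-point function `𝒞₁ rad(a, Ω)^{-1/8}`; conditional refutation from CHI Thm 1.3
(`k = 0`) + Wu: `Literature.Probability.LatticeModels.not_isConformallyCovariant_chiPlusCorr_of`
(`PlanarIsingCovarianceVanishing.lean`). **Replacement:** covariance of `chiPlusCorr` between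
admissible domains satisfying `Literature.Probability.LatticeModels.MeshApproximates`, the proved
theorem `Literature.Probability.LatticeModels.chiPlusCorr_covariant_of_hausdorff`
(`PlanarIsingOnePoint.lean`, from `chi_conformal_invariance_hausdorff`). The statement below is
unchanged and kept only because those theorems name it.
[cite: ChelkakHonglerIzyurov2015, Thm 1.2 — MIS-TRANSCRIBED for the fixed scheme between all admissible domains, without the approximation hypothesis; corrected as chiPlusCorr_covariant_of_hausdorff] -/
@[deprecated "mis-stated (CHI's covariance, arXiv:1202.2838 Thm 1.3 eq. (1.2), transfers to the limit family only along discretisations approximating Ω, §1.1 and §2.6; as stated it forces the one-point function to vanish everywhere, Literature.Probability.LatticeModels.chiPlusCorr_onePoint_eq_zero_of_covariant, and is conditionally refuted by not_isConformallyCovariant_chiPlusCorr_of): use Literature.Probability.LatticeModels.chiPlusCorr_covariant_of_hausdorff of PlanarIsingOnePoint.lean" (since := "2026-08-15")]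
def isConformallyCovariant_chiPlusCorr : Prop :=
  IsConformallyCovariant (1 / 8) chiPlusCorr

/- interim proof relied on results that are now named facts (D-0014); demoted to a fact by the M5 import, proof preserved:
:= by
  obtain ⟨S, C, -, hS, h⟩ := chi_conformal_invariance
  have key : ∀ Ω, IsAdmissibleDomain Ω → ∀ n (a : Fin n → ℂ), Function.Injective a →
      (∀ i, a i ∈ Ω) → chiPlusCorr Ω n a = C ^ n * S Ω n a :=
    fun Ω hΩ n a ha haΩ => (h Ω hΩ n a ha haΩ).limUnder_eq
  intro Ω Ω' φ hΩ hΩ' hφ n a ha haΩ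
  have ha' : Function.Injective fun i => φ (a i) :=
    fun i j hij => ha (hφ.2.injOn (haΩ i) (haΩ j) hij)
  rw [key Ω hΩ n a ha haΩ, key Ω' hΩ' n _ ha' fun i => hφ.2.mapsTo (haΩ i),
    hS Ω Ω' φ hΩ hΩ' hφ n a ha haΩ]
  ring
-/

/-- **Deprecated record — REFUTED as stated**
(`Literature.Probability.LatticeModels.not_chi_halfplane_onePoint`, `PlanarIsingSlitDisc.lean`;
prove-seat verdict; verdict clean-up 2026-08-15; never use it as a hypothesis — anything follows
from it). First transcription of the explicit one-point function of **crit-ising.S14**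
(Chelkak–Hongler–Izyurov, Ann. Math. 181 (2015), Thm 1.3 (`k = 0`) with the covariance (1.2) and
the half-plane value (1.3) `⟨σ_a⟩⁺_ℍ = 2^{1/4} (2 Im a)^{-1/8}`, in the `δ^{-1/8}` normalisation of
Rem. 1.2 (iii)), transported to a bounded simply connected `Ω` by a conformal bijection
`φ : Ω → ℍ` (`⟨σ_a⟩⁺_Ω = |φ'(a)|^{1/8} ⟨σ_{φ(a)}⟩⁺_ℍ`): "there is one positive constant `𝒞` (CHI's
`𝒞_σ · 2^{1/4}`, `𝒞_σ = 2^{5/48} e^{-3ζ'(-1)/2}`; the convention is theirs and is not fixed here)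
with `lim_{δ → 0⁺} δ^{-1/8} 𝔼⁺_{Ω_δ}[σ_a] = 𝒞 · |φ'(a)|^{1/8} · (2 Im φ(a))^{-1/8}` for every
admissible `Ω`, conformal bijection `φ : Ω → ℍ` and `a ∈ Ω`." **What is wrong:** the statement
omits CHI's standing hypothesis that the discrete domains approximate `Ω` (`∂Ω_δ → ∂Ω` in the
Hausdorff sense; arXiv:1202.2838 §1.1, Thms 1.1 and 1.3: "`Ω_δ` discretizations of `Ω`", §2.6);
with the fixed scheme `meshDomain` a slit carrying no lattice point is invisible, so the unit disc
and the disc slit along `{t e^{iπ/3} | t ≥ 1/4}` get the same left-hand side and different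
right-hand sides (`rad(0, ·) = 1` versus `16/25`) — hence the PROVED negation
`not_chi_halfplane_onePoint`. **Replacement:**
`Literature.Probability.LatticeModels.chi_halfplane_onePoint_hausdorff` (`PlanarIsingOnePoint.lean`,
extra hypothesis `MeshApproximates Ω`, proved there from CHI Thm 1.3 + Wu as named facts;
non-vacuous on the disc by `meshApproximates_ball`, `PlanarIsingDiscApprox.lean`). The statement
below is unchanged and kept only because its refutation names it.
[cite: ChelkakHonglerIzyurovAnnals2015, Thm. 1.1 eq. (1.2) with (1.3) — MIS-TRANSCRIBED without the approximation hypothesis; REFUTED in tree by not_chi_halfplane_onePoint; corrected as chi_halfplane_onePoint_hausdorff] -/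
@[deprecated "refuted as stated (Literature.Probability.LatticeModels.not_chi_halfplane_onePoint, PlanarIsingSlitDisc.lean: the statement omits CHI's hypothesis that the discrete domains approximate Ω, arXiv:1202.2838 §1.1 and §2.6): use Literature.Probability.LatticeModels.chi_halfplane_onePoint_hausdorff of PlanarIsingOnePoint.lean" (since := "2026-08-15")]
def chi_halfplane_onePoint : Prop :=
  ∃ C : ℝ, 0 < C ∧ ∀ (Ω : Set ℂ) (φ : ℂ → ℂ), IsAdmissibleDomain Ω →
      IsConformalBijection φ Ω UpperHalfPlane.upperHalfPlaneSet → ∀ a ∈ Ω,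
        chiPlusCorr Ω 1 ![a] =
          C * ‖deriv φ a‖ ^ ((1 : ℝ) / 8) * (2 * (φ a).im) ^ (-(1 : ℝ) / 8)

end Literature.Probability.LatticeModels
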